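import Literature.Probability.Percolation.ZdFourArmOutLanded
import Literature.Probability.Percolation.ZdFiveArmSeparatedE
import HarnessLib

/-!
# The five-arm event of bond percolation on `ℤ²` fenced and landed on the OUTER square only (edge-disjoint right arms)

Topic `Literature/Probability/Percolation`; critical bond percolation on `ℤ²`. DEFINITIONS and their
structural lemmas (no named fact).

The intermediate event `O n N` of Kesten's arm-separation scheme for FIVE arms
(`DuminilCopinManolescuTassion2021_zdFiveArm_upperBound_of_separationInputs`,
`ZdFiveArmUpperBoundOfScheme.lean`), companion of the four-arm `zdFourArmOutLanded`
(`ZdFourArmOutLanded.lean`, whose outer-fenced arms `ZdOutOpenArmR/L`, `ZdOutDualArmT/B`, their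
monotonicity, raising of the inner radius and transport are reused): after the external half of
the scheme the five arms of `zdFiveArmClusters n N` are fenced and landed on the fixed zones of the
OUTER square as in `zdFiveArmSepE n N` (`ZdFiveArmSeparatedE.lean`) — two outer-fenced open arms
to the right sides at heights `±[N/4, N/4 + N/64]` with DISJOINT EDGE CARRIERS (body, outer fence,
outer attaching walk), an outer-fenced open arm to the left side, outer-fenced closed dual arms to
the top and bottom sides — while the inner extremities are free on `∂B(n)`.

* `ZdOutOpenArmR.edgeCarrier`, `zdOutOpenPairRE n N`, `zdFiveArmOutLandedE n N`,
  `isUpperSet_zdOutOpenPairRE`;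
* `zdFiveArmSepE_subset_zdFiveArmOutLandedE` — forgetting the inner fences (`64 ≤ n`);
* `zdFiveArmOutLandedE_mono_left` — raising the inner radius `m ≤ m' ≤ N` (the cut bodies are
  suffixes of the old ones, so edge-disjointness is kept);
* `determinedBy_zdFiveArmOutLandedE`, `measurableSet_zdFiveArmOutLandedE` — locality on the pairs
  of `B(N + N/8 + 1) ∖ B(n-1)` (`1 ≤ n`, `2n ≤ N`).

## References

* H. Kesten, *Scaling relations for 2D-percolation*, Comm. Math. Phys. 109 (1987), §2, Lemmas 4–5
  [KestenScalingCMP1987].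
* P. Nolin, *Near-critical percolation in two dimensions*, EJP 13 (2008), §4.2 Def. 7–9, §4.4 proof
  of Thm. 11 [arXiv 0711.4948: Def. 6–8, Thm. 10, pp. 12–13] [Nolin2008].
-/

noncomputable section

open MeasureTheory Set SimpleGraph

namespace Literature.Probability.Percolation

open LatticeModels

variable {ω ω' : BondConfig (Site 2)} {n m m' N : ℕ} {lo hi lo' hi' : ℤ}

/-! ### The edge carrier of an outer-fenced right arm -/

/-- The edges used by an outer-fenced right arm: body, outer fence crossing, outer attaching walk.
[folklore] -/
def ZdOutOpenArmR.edgeCarrier (A : ZdOutOpenArmR ω n N lo' hi') : Set (Sym2 (Site 2)) :=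
  {e | e ∈ A.W.edges ∨ e ∈ A.V.edges ∨ e ∈ A.P.edges}

/-- `mono` does not change the edge carrier. [folklore] -/
@[simp] theorem ZdOutOpenArmR.edgeCarrier_mono (A : ZdOutOpenArmR ω n N lo' hi') (h : ω ⊆ ω') :
    (A.mono h).edgeCarrier = A.edgeCarrier := rfl

/-- Forgetting the inner fence shrinks the edge carrier. [folklore] -/
theorem ZdSepOpenArmR.edgeCarrier_toOut (A : ZdSepOpenArmR ω n N lo hi lo' hi') (hn : 1 ≤ n) (hlo : -(n : ℤ) ≤ lo)
    (hhi : hi ≤ n) : (A.toOut hn hlo hhi).edgeCarrier ⊆ A.edgeCarrier := by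
  rintro e (he | he | he)
  · exact Or.inl he
  · exact Or.inr (Or.inl he)
  · exact Or.inr (Or.inr (Or.inl he))

/-! ### The events -/

/-- **Two outer-fenced open arms to the right sides with disjoint edge carriers**, outer landing
heights `[N/4, N/4 + N/64]` and `[-(N/4 + N/64), -N/4]`, inner ends free on `∂B(n)`.
[cite: Nolin2008, §4.2 (arXiv 0711.4948 Def. 8, the events Ā^{·/I'})] [cite: KestenScalingCMP1987, §2 (2.26)–(2.28), Lemma 4] -/
def zdOutOpenPairRE (n N : ℕ) : Set (BondConfig (Site 2)) :=
  {ω | ∃ (A : ZdOutOpenArmR ω n N (N / 4 : ℕ) ((N / 4 : ℕ) + (N / 64 : ℕ)))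
    (B : ZdOutOpenArmR ω n N (-((N / 4 : ℕ) + (N / 64 : ℕ) : ℤ)) (-(N / 4 : ℕ))),
    Disjoint A.edgeCarrier B.edgeCarrier}

/-- **The five-arm event fenced and landed on the outer square only** (Nolin's
`Ã̃^{·/η',I'}_{5,BWBBW}(n,N)` for bond-`ℤ²`, `η' = 1/64`, right arms edge-disjoint): the `O n N` of
the five-arm separation scheme. [cite: Nolin2008, §4.4, proof of Thm. 11, "1. External extremities" (arXiv 0711.4948: Thm. 10, p. 12)] [cite: KestenScalingCMP1987, §2 Lemma 4] -/
def zdFiveArmOutLandedE (n N : ℕ) : Set (BondConfig (Site 2)) :=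
  (zdOutOpenPairRE n N ∩ zdOutOpenArmL n N) ∩ (zdOutDualArmT n N ∩ zdOutDualArmB n N)

/-- The right pair event is increasing. [folklore] -/
theorem isUpperSet_zdOutOpenPairRE (n N : ℕ) : IsUpperSet (zdOutOpenPairRE n N) := by
  rintro ω ω' hle ⟨A, B, hAB⟩
  exact ⟨A.mono hle, B.mono hle, by simpa using hAB⟩

/-- The left arm event is increasing. [folklore] -/
theorem isUpperSet_zdOutOpenArmL (n N : ℕ) : IsUpperSet (zdOutOpenArmL n N) := by
  rintro ω ω' hle ⟨B⟩
  exact ⟨B.mono hle⟩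

/-- The increasing part of the outer-landed five-arm event. [folklore] -/
theorem isUpperSet_zdOutOpenPairRE_inter_zdOutOpenArmL (n N : ℕ) :
    IsUpperSet (zdOutOpenPairRE n N ∩ zdOutOpenArmL n N) :=
  (isUpperSet_zdOutOpenPairRE n N).inter (isUpperSet_zdOutOpenArmL n N)

/-! ### Forgetting the inner fences -/

/-- **`zdFiveArmSepE n N ⊆ zdFiveArmOutLandedE n N`** (`64 ≤ n`). [folklore] -/
theorem zdFiveArmSepE_subset_zdFiveArmOutLandedE (hn : 64 ≤ n) :
    zdFiveArmSepE n N ⊆ zdFiveArmOutLandedE n N := by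
  rintro ω ⟨⟨⟨A, B, hAB⟩, ⟨BL⟩⟩, ⟨⟨T⟩, ⟨D⟩⟩⟩
  have h64 : ((n / 64 : ℕ) : ℤ) + 1 ≤ n := by
    have : n / 64 + 1 ≤ n := by omega
    exact_mod_cast this
  have h4 : ((n / 4 : ℕ) : ℤ) + (n / 64 : ℕ) ≤ n := by
    have : n / 4 + n / 64 ≤ n := by omega
    exact_mod_cast this
  have h0 : (0 : ℤ) ≤ (n / 4 : ℕ) := by positivity
  have h0' : (0 : ℤ) ≤ (n / 64 : ℕ) := by positivity
  refine ⟨⟨⟨A.toOut (by omega) (by linarith) h4, B.toOut (by omega) (by linarith) (by linarith), ?_⟩, ⟨BL.toOut (by omega) (by omega) (by omega)⟩⟩,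
    ⟨⟨T.toOut (by omega) (by omega) h64⟩, ⟨D.toOut (by omega) (by omega) h64⟩⟩⟩
  exact hAB.mono (A.edgeCarrier_toOut _ _ _) (B.edgeCarrier_toOut _ _ _)

/-! ### Raising the inner radius -/

/-- **Raising the inner radius of an outer-fenced right arm, with edges** (`m ≤ m' ≤ N`): keep the
part of the body after its last visit to `B(m'-1)`; the edge carrier shrinks. [folklore] -/
theorem ZdOutOpenArmR.exists_of_le (A : ZdOutOpenArmR ω m N lo' hi') (hmm' : m ≤ m') (hm'N : m' ≤ N) :
    ∃ A' : ZdOutOpenArmR ω m' N lo' hi', A'.edgeCarrier ⊆ A.edgeCarrier := by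
  have hm : 1 ≤ m := one_le_of_mem_siteSphere A.hx
  rcases Nat.eq_or_lt_of_le hmm' with rfl | hlt
  · exact ⟨A, le_rfl⟩
  have hz := A.hz
  have hzA : A.z ∈ ({v | v ∉ box 2 (m' - 1)} : Set (Site 2)) := by
    intro h'
    have := (mem_box.1 h' 0).2
    omega
  have hxA : A.x ∉ ({v | v ∉ box 2 (m' - 1)} : Set (Site 2)) := by
    have hx := A.hx
    simp only [siteSphere, Finset.mem_sdiff] at hx
    exact fun h' => h' (box_mono 2 (by omega) hx.1)
  obtain ⟨x', z', q, hx'z', hz', hA', hS', hE', -⟩ :=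
    exists_prefix_exit (A := {v | v ∉ box 2 (m' - 1)}) A.W.reverse hzA hxA
  have hz'box : z' ∈ box 2 (m' - 1) := not_not.1 hz'
  have hx'a : x' ∈ box 2 m' := mem_box_of_adj_of_mem_box_pred (by omega) hz'box hx'z'.symm
  refine ⟨{ A with
    x := x'
    W := q.reverse
    hx := Finset.mem_sdiff.2 ⟨hx'a, hA' x' q.end_mem_support⟩
    hW := fun v hv => ?_
    hWo := fun e he => ?_ }, ?_⟩
  · rw [Walk.support_reverse, List.mem_reverse] at hv
    have h1 : v ∈ A.W.support := by
      have := hS' v hv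
      rwa [Walk.support_reverse, List.mem_reverse] at this
    exact mem_sqAnnulus_of_notMem_box (A.hW v h1) (hA' v hv)
  · rw [Walk.edges_reverse, List.mem_reverse] at he
    have := hE' e he
    rw [Walk.edges_reverse, List.mem_reverse] at this
    exact A.hWo e this
  · rintro e (he | he | he)
    · rw [Walk.edges_reverse, List.mem_reverse] at he
      have := hE' e he
      rw [Walk.edges_reverse, List.mem_reverse] at this
      exact Or.inl this
    · exact Or.inr (Or.inl he)
    · exact Or.inr (Or.inr he)

/-- **Raising the inner radius: `zdFiveArmOutLandedE m N ⊆ zdFiveArmOutLandedE m' N`** for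
`m ≤ m' ≤ N`. [cite: Nolin2008, §4.4, proof of Thm. 11, internal extremities (arXiv 0711.4948: Thm. 10, p. 13)] -/
theorem zdFiveArmOutLandedE_mono_left (hmm' : m ≤ m') (hm'N : m' ≤ N) :
    zdFiveArmOutLandedE m N ⊆ zdFiveArmOutLandedE m' N := by
  rintro ω ⟨⟨⟨A, B, hAB⟩, ⟨BL⟩⟩, ⟨⟨T⟩, ⟨D⟩⟩⟩
  have hm'1 : 1 ≤ m' := (one_le_of_mem_siteSphere A.hx).trans hmm'
  obtain ⟨A', hA'⟩ := A.exists_of_le hmm' hm'N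
  obtain ⟨B', hB'⟩ := B.exists_of_le hmm' hm'N
  exact ⟨⟨⟨A', B', hAB.mono hA' hB'⟩, BL.nonempty_of_le hmm' hm'N⟩,
    ⟨T.nonempty_of_le hm'1 hmm', D.nonempty_of_le hm'1 hmm'⟩⟩

/-! ### Locality -/

/-- **Transport of an outer-fenced right arm with landing heights `|·| ≤ N/4 + N/64`** along
configurations agreeing on `outLandedPairs` (`1 ≤ n`, `2n ≤ N`). [folklore] -/
def ZdOutOpenArmR.transport' (A : ZdOutOpenArmR ω n N lo' hi') (hn : 1 ≤ n) (h2 : 2 * n ≤ N)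
    (hlo' : -(((N / 4 : ℕ) : ℤ) + (N / 64 : ℕ)) ≤ lo') (hhi' : hi' ≤ ((N / 4 : ℕ) : ℤ) + (N / 64 : ℕ))
    (h : ∀ e ∈ (outLandedPairs n N : Set (Sym2 (Site 2))), e ∈ ω → e ∈ ω') : ZdOutOpenArmR ω' n N lo' hi' :=
  have hz := A.hz
  have h8 : (N / 8 : ℕ) ≤ N := Nat.div_le_self N 8
  have h64 : (N / 64 : ℕ) ≤ N / 8 := Nat.div_le_div_left (by norm_num) (by norm_num)
  have h4 : N / 4 + N / 64 + N / 64 + N / 8 ≤ N := by omega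
  have h4' : ((N / 4 : ℕ) : ℤ) + (N / 64 : ℕ) + (N / 64 : ℕ) + (N / 8 : ℕ) ≤ N := by exact_mod_cast h4
  have h82 : 2 * (N / 8) + 2 ≤ N + 2 := by omega
  { A with
    hWo := fun e he => h e (mem_outLandedPairs_of_forall hn fun v hv =>
      outLanded_site_of_mem_sqAnnulus hn (A.hW v (forall_mem_support_of_mem_edges A.W he v hv))) (A.hWo e he)
    hVo := fun e he => h e (mem_outLandedPairs_of_forall hn fun v hv => by
      obtain ⟨a0, a0', a1⟩ := A.hV v (forall_mem_support_of_mem_edges A.V he v hv)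
      have e1 := abs_le.1 a1
      exact ⟨Fin.forall_fin_two.2 ⟨⟨by omega, by omega⟩, ⟨by omega, by omega⟩⟩, 0, Or.inl (by omega)⟩) (A.hVo e he)
    hPo := fun e he => h e (mem_outLandedPairs_of_forall hn fun v hv => by
      obtain ⟨a0, a1⟩ := A.hP v (forall_mem_support_of_mem_edges A.P he v hv)
      have e0 := abs_le.1 (show |v 0 - A.z 0| ≤ (N / 8 : ℕ) by omega)
      have e1 := abs_le.1 (show |v 1 - A.z 1| ≤ (N / 8 : ℕ) by omega)
      exact ⟨Fin.forall_fin_two.2 ⟨⟨by omega, by omega⟩, ⟨by omega, by omega⟩⟩, 0, Or.inl (by omega)⟩) (A.hPo e he) }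

/-- `transport'` does not change the edge carrier. [folklore] -/
@[simp] theorem ZdOutOpenArmR.edgeCarrier_transport' (A : ZdOutOpenArmR ω n N lo' hi') (hn : 1 ≤ n) (h2 : 2 * n ≤ N)
    (hlo' : -(((N / 4 : ℕ) : ℤ) + (N / 64 : ℕ)) ≤ lo') (hhi' : hi' ≤ ((N / 4 : ℕ) : ℤ) + (N / 64 : ℕ))
    (h : ∀ e ∈ (outLandedPairs n N : Set (Sym2 (Site 2))), e ∈ ω → e ∈ ω') :
    (A.transport' hn h2 hlo' hhi' h).edgeCarrier = A.edgeCarrier := rfl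

/-- **The outer-landed five-arm event is determined by the pairs of `B(N + N/8 + 1) ∖ B(n-1)`**
(`1 ≤ n`, `2n ≤ N`). [folklore] -/
theorem determinedBy_zdFiveArmOutLandedE (hn : 1 ≤ n) (h2 : 2 * n ≤ N) :
    DeterminedBy (zdFiveArmOutLandedE n N) ↑(outLandedPairs n N) := by
  have h0 : -((N / 64 : ℕ) : ℤ) ≤ 0 := by omega
  have hq : (0 : ℤ) ≤ (N / 4 : ℕ) := by positivity
  have hq' : (0 : ℤ) ≤ (N / 64 : ℕ) := by positivity
  suffices key : ∀ ω ω' : BondConfig (Site 2), ω ∩ ↑(outLandedPairs n N) = ω' ∩ ↑(outLandedPairs n N) →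
      ω ∈ zdFiveArmOutLandedE n N → ω' ∈ zdFiveArmOutLandedE n N by
    rw [determinedBy_iff]
    exact fun ω ω' h => ⟨key ω ω' h, key ω' ω h.symm⟩
  rintro ω ω' h ⟨⟨⟨A, B, hAB⟩, ⟨BL⟩⟩, ⟨⟨T⟩, ⟨D⟩⟩⟩
  have hop : ∀ e ∈ (outLandedPairs n N : Set (Sym2 (Site 2))), e ∈ ω → e ∈ ω' :=
    fun e he heω => mem_of_inter_eq h he heω
  have hcl : ∀ e ∈ (outLandedPairs n N : Set (Sym2 (Site 2))), e ∉ ω → e ∉ ω' :=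
    fun e he heω h' => heω (mem_of_inter_eq h.symm he h')
  refine ⟨⟨⟨A.transport' hn h2 (by linarith) le_rfl hop, B.transport' hn h2 le_rfl (by linarith) hop, ?_⟩,
    ⟨BL.transport hn h2 h0 le_rfl hop⟩⟩, ⟨⟨T.transport hn h2 h0 le_rfl hcl⟩, ⟨D.transport hn h2 h0 le_rfl hcl⟩⟩⟩
  simpa using hAB

/-- The outer-landed five-arm event is measurable (`1 ≤ n`, `2n ≤ N`). [folklore] -/
theorem measurableSet_zdFiveArmOutLandedE (hn : 1 ≤ n) (h2 : 2 * n ≤ N) :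
    MeasurableSet (zdFiveArmOutLandedE n N) :=
  (determinedBy_zdFiveArmOutLandedE hn h2).measurableSet_of_finset

end Literature.Probability.Percolation
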